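import Literature.MathematicalPhysics.QuantumManyBody.JelliumBoseGasDilation
import HarnessLib

/-!
# Foldy's law: the final reduction to two unit-coupling finite-volume bounds

Topic `Literature/MathematicalPhysics/QuantumManyBody`, third companion of `JelliumBoseGas.lean`
(provefact `Literature.MathematicalPhysics.QuantumManyBody.JelliumBoseGas.foldyLaw`,
[LSSY2005, Thm. 10.1]); combines `foldyLaw_iff_one` (`JelliumBoseGasDilation.lean`: exact
dilation covariance, all couplings `q` from `q = 1`) with the splitting into one-sided bounds
(`foldyLaw_iff_bounds`, `JelliumBoseGasProofs.lean`):

* `foldyLaw_of_bounds_one` — `foldyLaw` follows from the two finite-volume bounds for the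
  UNIT-charge Dirichlet jellium Hamiltonian `-∑Δᵢ + U` in the box `L = (N/ρ)^{1/3}`:
  for every `ε > 0`, for all large `ρ`, eventually in `N`,
  `E₀(N, L)/N ≥ (-foldyConstant - ε) ρ^{1/4}` (the Lieb–Solovej lower bound
  [LiebSolovej2001, Thm. 1.1]) and `E₀(N, L)/N ≤ (-foldyConstant + ε) ρ^{1/4}` (Solovej's upper
  bound [Solovej2006, Thm. 1.1]);
* `foldyLaw.bounds_one` — conversely (the reduction is lossless).

These two displayed inequalities are therefore EXACTLY what remains to discharge the named fact
`foldyLaw`; both are deep (rigorous Bogoliubov theory) and are not proved in the tree.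

## References

* [LSSY2005] E. H. Lieb, R. Seiringer, J. P. Solovej, J. Yngvason, *The Mathematics of the Bose
  Gas and its Condensation*, Birkhäuser 2005 (arXiv:cond-mat/0610117): Thm. 10.1 with (10.2).
* [LiebSolovej2001] E. H. Lieb, J. P. Solovej, Commun. Math. Phys. 217 (2001) 127–163, Thm. 1.1;
  Errata 225 (2002) 219–221.
* [Solovej2006] J. P. Solovej, Commun. Math. Phys. 266 (2006) 797–818, Thm. 1.1.
-/

noncomputable section

open MeasureTheory Filter Metric
open scoped ENNReal NNReal Topology

namespace Literature.MathematicalPhysics.QuantumManyBody.JelliumBoseGas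

open BoseGas

/-- **What `foldyLaw_holds` needs, in final form.** Foldy's law (all couplings) follows from —
and, by `foldyLaw_iff_one` and `foldyLaw_iff_bounds`, is equivalent to — the two finite-volume
bounds for the UNIT-charge jellium Hamiltonian `-∑Δᵢ + U` in the Dirichlet box
`L = (N/ρ)^{1/3}`: for every `ε > 0` there is `ρ₀` such that for `ρ ≥ ρ₀`, eventually in `N`,
(lower) `E₀(N, L)/N ≥ (-foldyConstant - ε) ρ^{1/4}` — the Lieb–Solovej lower bound
[LiebSolovej2001, Thm. 1.1] — and (upper) `E₀(N, L)/N ≤ (-foldyConstant + ε) ρ^{1/4}` —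
Solovej's upper bound [Solovej2006, Thm. 1.1]; `E₀ = chargedGroundStateEnergy - shift` is finite
by `eventually_chargedGroundStateEnergy_ne_top`. [cite: LSSY2005, Thm. 10.1 (10.2)] -/
theorem foldyLaw_of_bounds_one
    (hlow : ∀ ε : ℝ, 0 < ε → ∃ ρ₀ : ℝ, 0 < ρ₀ ∧ ∀ ρ : ℝ, ρ₀ ≤ ρ → ∀ᶠ N : ℕ in atTop,
      (-foldyConstant - ε) * ρ ^ (1 / 4 : ℝ) ≤
        ((chargedGroundStateEnergy 0 1 ρ N (sideLength ρ N)).toReal -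
            jelliumEnergyShift 1 ρ N (sideLength ρ N)) / N)
    (hup : ∀ ε : ℝ, 0 < ε → ∃ ρ₀ : ℝ, 0 < ρ₀ ∧ ∀ ρ : ℝ, ρ₀ ≤ ρ → ∀ᶠ N : ℕ in atTop,
      ((chargedGroundStateEnergy 0 1 ρ N (sideLength ρ N)).toReal -
            jelliumEnergyShift 1 ρ N (sideLength ρ N)) / N ≤
        (-foldyConstant + ε) * ρ ^ (1 / 4 : ℝ)) :
    foldyLaw := by
  refine foldyLaw_iff_one.2 fun ε hε => ?_
  obtain ⟨ρ₁, hρ₁, h₁⟩ := hlow ε hε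
  obtain ⟨ρ₂, -, h₂⟩ := hup ε hε
  refine ⟨max ρ₁ ρ₂, lt_max_of_lt_left hρ₁, fun ρ hρ => ?_⟩
  have hρ0 : 0 < ρ := hρ₁.trans_le ((le_max_left _ _).trans hρ)
  filter_upwards [h₁ ρ ((le_max_left _ _).trans hρ), h₂ ρ ((le_max_right _ _).trans hρ),
    eventually_chargedGroundStateEnergy_ne_top hρ0 1] with N hl hu hfin
  refine ⟨hfin, abs_le.2 ⟨?_, ?_⟩⟩
  · linarith
  · linarith

/-- Conversely Foldy's law gives both unit-coupling bounds (so the reduction is lossless).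
[cite: LSSY2005, Thm. 10.1 (10.2)] -/
theorem foldyLaw.bounds_one (h : foldyLaw) :
    (∀ ε : ℝ, 0 < ε → ∃ ρ₀ : ℝ, 0 < ρ₀ ∧ ∀ ρ : ℝ, ρ₀ ≤ ρ → ∀ᶠ N : ℕ in atTop,
      (-foldyConstant - ε) * ρ ^ (1 / 4 : ℝ) ≤
        ((chargedGroundStateEnergy 0 1 ρ N (sideLength ρ N)).toReal -
            jelliumEnergyShift 1 ρ N (sideLength ρ N)) / N) ∧
    ∀ ε : ℝ, 0 < ε → ∃ ρ₀ : ℝ, 0 < ρ₀ ∧ ∀ ρ : ℝ, ρ₀ ≤ ρ → ∀ᶠ N : ℕ in atTop,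
      ((chargedGroundStateEnergy 0 1 ρ N (sideLength ρ N)).toReal -
            jelliumEnergyShift 1 ρ N (sideLength ρ N)) / N ≤
        (-foldyConstant + ε) * ρ ^ (1 / 4 : ℝ) := by
  have h1 := foldyLaw_iff_one.1 h
  refine ⟨fun ε hε => ?_, fun ε hε => ?_⟩
  · obtain ⟨ρ₀, hρ₀, hρ⟩ := h1 ε hε
    refine ⟨ρ₀, hρ₀, fun ρ hle => ?_⟩
    filter_upwards [hρ ρ hle] with N hN
    have := (abs_le.1 hN.2).1
    linarith
  · obtain ⟨ρ₀, hρ₀, hρ⟩ := h1 ε hε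
    refine ⟨ρ₀, hρ₀, fun ρ hle => ?_⟩
    filter_upwards [hρ ρ hle] with N hN
    have := (abs_le.1 hN.2).2
    linarith

end Literature.MathematicalPhysics.QuantumManyBody.JelliumBoseGas
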